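import Mathlib
import HarnessLib
import Literature.Computability.AlgebraicComplexity.BDI20HwvEvaluationHardness

/-!
# Bläser–Dörfler–Ikenmeyer 2020, §8: grid-like layered multigraphs (Def. 24) and their
# decomposition into two semistandard two-row tableaux (Lemma 25) (CCC 2021 Def. 8.3, Lemma 8.4)

M. Bläser, J. Dörfler, C. Ikenmeyer, *On the complexity of evaluating highest weight vectors*,
arXiv:2002.11594 (= CCC 2021, LIPIcs 200:29), §8. TeX of record: `HOME/lit/src/2002.11594/fullversion.tex`
(val-lit lit g12, v2 e-print, sha16 9e732dfe87cd0d83): Def. 24 `def:gridlike` L1665–1678 (arXiv page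
text p0018:L17–31), Fig. `fig:gridlikeexample` L1681–1703, Lemma 25 `lem:gridlikedecomp` L1705–1710 with
proof L1711–1740 (p0018:L38–70), Fig. `fig:gridlikeexampledecomp` L1741–1790; the relational grid
colouring problem of Lemma 28 `lem:3colgrid`, prose L2078–2079, statement L2083–2086. Numbering: arXiv
flat (CCC 2021 in brackets): Def. 24 [8.3], Lemma 25 [8.4], Lemma 26 [8.5], Lemma 28 [8.7], Lemma 29
[8.8], Thm. 30 [8.9]. Cell val-lit, typer t20 g10; FILE A of the §8 programme sized in
`HOME/np/MEMO-t21g11-BDI20-sec8-gadgets.md` (t21 g11), lead-np RULING (124); FILE B (the Lemma-26/28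
gadgets as data) is `BDI20ColouringGadgets.lean`; the statement file of §8 is
`BDI20HwvEvaluationHardness.lean` (facts `BDI2020_thm_8_9`, `BDI2020_thm_8_9_eth`, whose printed proof
consumes Lemma 25 through Thm. 30's tableau `T̂ = T₁ T₂ T₃ T₄ T₅`, `T_{3,2}` = `T̂_↕` doubled, `T₅` =
`T̂_↔` doubled, TeX L2390–2391). HONEST FRAMING: vocabulary and one combinatorial lemma of an NP- and ETH-
hardness proof about EVALUATING highest weight vectors; nothing here bears on `VP` versus `VNP`, which
is NOT proved.

## What the source prints and how it is rendered

* **Def. 24 [8.3]** (TeX L1665–1678): "We call a planar multigraph `G = (V, E)` grid-like layered if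
  there are disjoint layers `L_1, …, L_k ⊆ V` of vertices and an embedding `e : V → ℕ × {1,…,k}`, s.t.
  (1) `e` is injective. (2) For every `i` we have `e^{-1}(ℕ × {i}) = L_i` (3) Edges between layers
  only exist between layer `L_i` and `L_{i+1}` … (4) Edges inside layers only exist for vertices
  `v, u ∈ L_i` where `e(v) = e(u) ± (1,0)` … (5) All edges can be drawn as straight lines without
  crossing when vertices are placed according to `e` in `ℝ²` and the graph is treated as being simple.
  (6) Every vertex has a neighbour in a different layer."
  = `GridLikeLayered n`: vertex set `Fin n`, `pos = e` (so (2) is definitional: the layer of `v` IS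
  `(pos v).2`), a symmetric loopless multiplicity function `mult` (the multigraph), and (1), (3), (4),
  (6) verbatim. RENDERING OF (5) (disclosed; the memo's recommendation): with integer positions,
  (3) and (4), a straight-line edge inside a layer is a unit horizontal segment and an edge between
  layers `i`, `i+1` lies in the open strip between them except for its end points, so the only pairs
  of edges that can cross are two edges between the same consecutive layers, and they cross iff their
  lower and upper end points are oppositely ordered; (5) is therefore rendered as the field
  `noncrossing` ("lower ends strictly left-to-right ⇒ upper ends weakly left-to-right"), which is
  exactly what the proof of Lemma 25 takes from (5): "Condition 5 gives a unique order of the edges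
  between these layers from left to right." No topological planarity is formalised.
* **Lemma 25 [8.4]** (TeX L1705–1710): "Let `G = (V, E)` be a grid-like layered graph. Then
  `G = (V, E(G_{T̂_↔}) ∪ E(G_{T̂_↕}))` for two semistandard tableaux `T̂_↔, T̂_↕` for some relabeling
  of the vertices `V`. Additionally `T̂_↕` contains every number from `1` to `|V|` at least once."
  Proof (L1711–1740): relabel "in increasing order inside each layer according to `e` and then
  increasing order from layer `L_i` to layer `L_{i+1}`" (= `label`, the rank in the `(layer, x)`
  order `KeyLT`; labels `0, …, n-1` here, `1, …, |V|` in print; `label_injective`, `label_lt`,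
  `labelFin_bijective`); `E_↕` = edges between layers, `E_↔` = edges inside layers (`IsInter`,
  `IsIntra`, lower/left end first); `T̂_↕` = the columns `(u over v)`, `u < v`, "in the unique order
  from left to right", with multiplicity (`interCols` = `rawInter` put in the lexicographic column
  order `ColLE` by insertion sort — the print's left-to-right order layer pair by layer pair);
  `T̂_↔` = the columns `(v over v+1)` (`intraCols`; `label_eq_label_add_one_of_isIntra`). PROVED, in
  the tree's tableau vocabulary of `BDI20HwvEvaluationHardness.lean` (`BDI2020.IsSemistandard`,
  columns as lists, `BDI2020.tableauGraph` = the graph `G_S` of §7): `isSemistandard_interCols`,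
  `isSemistandard_intraCols` (the two arguments of the proof; the first uses `noncrossing` through
  `label_le_of_colLE_of_isInter`), all columns of height `2`, `mem_interCols_iff` /
  `mem_intraCols_iff` (the columns are exactly the edges), `count_interCols_col` /
  `count_intraCols_col` ("we add every column to the tableaux `k` times if the edge appears with
  multiplicity `k`"), ★ `tableauGraph_cols_adj_iff` (the relabelled `G`, as a simple graph, IS
  `G_{T̂_↕ T̂_↔} = G_{T̂_↕} ⊔ G_{T̂_↔}`, `tableauGraph_append`), `count_cols_add_count_cols` (the same
  with multiplicity), ★ `sum_count_label` (every label occurs `deg` times in `T̂_↕ T̂_↔` — what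
  Thm. 30's "`T̂` contains every entry exactly `16` times" consumes for `8`-regular `G` after doubling,
  `sum_count_label_of_isRegular`), ★ `exists_mem_interCols_label_mem` ("`T̂_↕` contains every
  number", from (6)).
* **Fig. `fig:gridlikeexample` / `fig:gridlikeexampledecomp`** (TeX L1681–1703, L1741–1790): the
  `7`-vertex example with its printed `T̂_↔ = (1 2 6 / 2 3 7)` and `T̂_↕ = (1 1 2 3 5 5 / 4 5 5 5 6 7)`
  = `exampleGraph` (all six Def-24 fields by `decide`: non-vacuity) with `exampleGraph_interCols`,
  `exampleGraph_intraCols` reproducing the printed tableaux (`0`-based) by `decide`.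
* **Lemma 28 [8.7], the problem** (TeX L2078–2079): "a variant of `3`-coloring where the graph is a
  subset of a grid graph and every edge can either be an equality or inequality edge, i.e. vertices
  connected by an equality edge have to be colored by the same color and vertices connected by an
  inequality edge have to be colored with different colors … relational `3`-coloring on subgraphs of
  grids" = `GridAdjacent`, `RelGridGraph N` (injective placement, Boolean symmetric `eqAdj` / `neAdj`,
  every edge a unit grid edge), `RelGridGraph.IsProperRel`, `IsRelColourable` — the vocabulary the
  Lemma-28 construction (memo FILE C) and the `8`-regularisation of Lemma 29 (FILE D) are stated in;
  and for Lemmas 26/29/Thm. 30: `GridLikeLayered.IsProper3`, `IsRegular`, `degree`.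

Nothing in this file is a conjecture or a named fact; no `instance` (two `haveI` local facts inside
proofs feed Mathlib's `List.pairwise_insertionSort`), no notation.

## References
* [BlaserDorflerIkenmeyer2020] M. Bläser, J. Dörfler, C. Ikenmeyer, *On the complexity of evaluating
  highest weight vectors*, arXiv:2002.11594 / CCC 2021 — Def. 24, Lemma 25, Figs. gridlikeexample /
  gridlikeexampledecomp, Lemma 28 (TeX lines above).
-/

namespace Literature.Computability.AlgebraicComplexity

namespace BDI2020

/-- **Def. 24 [8.3] (grid-like layered multigraph)** on the vertex set `Fin n`, with the embedding
`e(v) = pos v = (x, layer)` and edge multiplicities `mult` (a loopless multigraph): (1) `e` injective;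
(2) the layers ARE the fibres of the second coordinate (built in); (3) "Edges between layers only
exist between layer `L_i` and `L_{i+1}`"; (4) "Edges inside layers only exist for vertices `v, u ∈ L_i`
where `e(v) = e(u) ± (1,0)`"; (5) "All edges can be drawn as straight lines without crossing when
vertices are placed according to `e` in `ℝ²` and the graph is treated as being simple" — RENDERED by
its combinatorial content given (1), (3), (4): two edges between the same pair of consecutive layers
never have oppositely ordered end points (`noncrossing`; under (1)/(3)/(4) these are the only pairs of
straight-line edges that can cross at all, and this is exactly the "unique order of the edges between
these layers from left to right" that the proof of Lemma 25 extracts from (5)); (6) "Every vertex has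
a neighbour in a different layer". Layers and abscissae are natural numbers (the print's
`e : V → ℕ × {1, …, k}`; the number `k` of layers is not recorded).
[cite: BlaserDorflerIkenmeyer2020, Def. 24 (arXiv, TeX L1665–1678, p0018:L17–31; = CCC 2021 Def. 8.3)] -/
structure GridLikeLayered (n : ℕ) where
  /-- the embedding `e : V → ℕ × {layers}`, `e(v) = (x, layer)` -/
  pos : Fin n → ℕ × ℕ
  /-- edge multiplicities (`0` = no edge) -/
  mult : Fin n → Fin n → ℕ
  mult_comm : ∀ u v, mult u v = mult v u
  mult_self : ∀ v, mult v v = 0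
  /-- item (1) -/
  pos_injective : Function.Injective pos
  /-- item (3): an edge between different layers joins consecutive layers -/
  inter_adj : ∀ u v, 0 < mult u v → (pos u).2 ≠ (pos v).2 →
    (pos v).2 = (pos u).2 + 1 ∨ (pos u).2 = (pos v).2 + 1
  /-- item (4): an edge inside a layer joins horizontal neighbours `e(v) = e(u) ± (1,0)` -/
  intra_adj : ∀ u v, 0 < mult u v → (pos u).2 = (pos v).2 →
    (pos v).1 = (pos u).1 + 1 ∨ (pos u).1 = (pos v).1 + 1
  /-- item (5), combinatorial content: two edges from layer `i` to layer `i + 1` whose lower ends are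
  strictly ordered left to right have upper ends weakly ordered the same way -/
  noncrossing : ∀ u v u' v', 0 < mult u v → 0 < mult u' v' → (pos v).2 = (pos u).2 + 1 →
    (pos v').2 = (pos u').2 + 1 → (pos u').2 = (pos u).2 → (pos u).1 < (pos u').1 →
    (pos v).1 ≤ (pos v').1
  /-- item (6) -/
  exists_inter : ∀ u, ∃ v, 0 < mult u v ∧ (pos v).2 ≠ (pos u).2

namespace GridLikeLayered

variable {n : ℕ} (G : GridLikeLayered n)

/-- The degree of a vertex, edges counted with multiplicity ("`8`-regular, i.e. each vertex has degree
exactly `8`"). [cite: BlaserDorflerIkenmeyer2020, §8 before Def. 24 and Lemma 26 (arXiv, TeX L1663; = CCC 2021 §8, Lemma 8.5)] -/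
def degree (v : Fin n) : ℕ := ∑ w, G.mult v w

/-! ## The relabelling of Lemma 25: layer by layer, left to right -/

/-- The order in which Lemma 25 relabels the vertices: "in increasing order inside each layer according
to `e` and then increasing order from layer `L_i` to layer `L_{i+1}`", i.e. lexicographic in
`(layer, x) = ((pos v).2, (pos v).1)`. [cite: BlaserDorflerIkenmeyer2020, Lemma 25, proof (arXiv, TeX L1712–1713; = CCC 2021 Lemma 8.4)] -/
abbrev KeyLT (u v : Fin n) : Prop :=
  (G.pos u).2 < (G.pos v).2 ∨ ((G.pos u).2 = (G.pos v).2 ∧ (G.pos u).1 < (G.pos v).1)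

/-- The new label of a vertex: its rank in the `(layer, x)` order (labels `0, …, n-1`; the print uses
`1, …, |V|`). [cite: BlaserDorflerIkenmeyer2020, Lemma 25, proof (arXiv, TeX L1712–1713; = CCC 2021 Lemma 8.4)] -/
def label (v : Fin n) : ℕ := (Finset.univ.filter fun w => G.KeyLT w v).card

/-- The `(layer, x)` order is irreflexive. [cite: BlaserDorflerIkenmeyer2020, Def. 24 (1) and Lemma 25, proof (the `(layer, x)` order of the relabelling) (arXiv, TeX L1667, L1712–1713; = CCC 2021 Def. 8.3, Lemma 8.4)] -/
theorem keyLT_irrefl (v : Fin n) : ¬ G.KeyLT v v := by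
  unfold KeyLT; omega

/-- The `(layer, x)` order is transitive. [cite: BlaserDorflerIkenmeyer2020, Def. 24 (1) and Lemma 25, proof (the `(layer, x)` order of the relabelling) (arXiv, TeX L1667, L1712–1713; = CCC 2021 Def. 8.3, Lemma 8.4)] -/
theorem keyLT_trans {u v w : Fin n} (h₁ : G.KeyLT u v) (h₂ : G.KeyLT v w) : G.KeyLT u w := by
  unfold KeyLT at *; omega

/-- The `(layer, x)` order is asymmetric. [cite: BlaserDorflerIkenmeyer2020, Def. 24 (1) and Lemma 25, proof (the `(layer, x)` order of the relabelling) (arXiv, TeX L1667, L1712–1713; = CCC 2021 Def. 8.3, Lemma 8.4)] -/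
theorem keyLT_asymm {u v : Fin n} (h : G.KeyLT u v) : ¬ G.KeyLT v u := by
  unfold KeyLT at *; omega

/-- Two distinct vertices are comparable (item (1): `e` is injective).
[cite: BlaserDorflerIkenmeyer2020, Def. 24 (1) and Lemma 25, proof (arXiv; = CCC 2021 Def. 8.3, Lemma 8.4)] -/
theorem keyLT_or_keyLT {u v : Fin n} (h : u ≠ v) : G.KeyLT u v ∨ G.KeyLT v u := by
  by_contra hc
  simp only [KeyLT, not_or, not_and, not_lt] at hc
  apply h
  apply G.pos_injective
  exact Prod.ext (by omega) (by omega)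

/-- The relabelling is strictly monotone in the `(layer, x)` order.
[cite: BlaserDorflerIkenmeyer2020, Lemma 25, proof (arXiv; = CCC 2021 Lemma 8.4)] -/
theorem label_lt_label {u v : Fin n} (h : G.KeyLT u v) : G.label u < G.label v := by
  unfold label
  apply Finset.card_lt_card
  rw [Finset.ssubset_iff_of_subset]
  · exact ⟨u, by simp [h], by simp [G.keyLT_irrefl u]⟩
  · intro w hw
    simp only [Finset.mem_filter, Finset.mem_univ, true_and] at hw ⊢
    exact G.keyLT_trans hw h

/-- The new labels compare as the `(layer, x)` keys. [cite: BlaserDorflerIkenmeyer2020, Lemma 25, proof (arXiv, TeX L1711–1740; = CCC 2021 Lemma 8.4)] -/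
theorem label_lt_label_iff {u v : Fin n} : G.label u < G.label v ↔ G.KeyLT u v := by
  refine ⟨fun h => ?_, G.label_lt_label⟩
  by_cases huv : u = v
  · subst huv; exact absurd h (lt_irrefl _)
  rcases G.keyLT_or_keyLT huv with h' | h'
  · exact h'
  · exact absurd (G.label_lt_label h') (by omega)

/-- The new labels compare as the `(layer, x)` keys (weak form). [cite: BlaserDorflerIkenmeyer2020, Lemma 25, proof (arXiv, TeX L1711–1740; = CCC 2021 Lemma 8.4)] -/
theorem label_le_label_iff {u v : Fin n} : G.label u ≤ G.label v ↔ ¬ G.KeyLT v u := by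
  rw [← not_lt, G.label_lt_label_iff]

/-- The relabelling is injective … [cite: BlaserDorflerIkenmeyer2020, Lemma 25 ("for some relabeling of the vertices") (arXiv; = CCC 2021 Lemma 8.4)] -/
theorem label_injective : Function.Injective G.label := by
  intro u v h
  by_contra huv
  rcases G.keyLT_or_keyLT huv with h' | h'
  · exact absurd h (G.label_lt_label h').ne
  · exact absurd h (G.label_lt_label h').ne'

/-- … onto `{0, …, n-1}`. [cite: BlaserDorflerIkenmeyer2020, Lemma 25 (arXiv; = CCC 2021 Lemma 8.4)] -/
theorem label_lt (v : Fin n) : G.label v < n := by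
  have : (Finset.univ.filter fun w => G.KeyLT w v).card < (Finset.univ : Finset (Fin n)).card := by
    apply Finset.card_lt_card
    rw [Finset.ssubset_iff_of_subset (Finset.filter_subset _ _)]
    exact ⟨v, Finset.mem_univ _, by simp [G.keyLT_irrefl v]⟩
  rw [Finset.card_univ, Fintype.card_fin] at this
  exact this

/-- Equal new labels means equal vertices. [cite: BlaserDorflerIkenmeyer2020, Lemma 25, proof (arXiv, TeX L1711–1740; = CCC 2021 Lemma 8.4)] -/
@[simp] theorem label_eq_label_iff {u v : Fin n} : G.label u = G.label v ↔ u = v :=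
  G.label_injective.eq_iff

/-! ## Lemma 25: the two column lists `T̂_↕` (between layers) and `T̂_↔` (inside layers) -/

/-- `{u, v}` is an edge from layer `i` to layer `i + 1`, lower layer first (the print's `u < v` after
relabelling). [cite: BlaserDorflerIkenmeyer2020, Lemma 25, proof ("Let `E_↕` now be the edges between different layers") (arXiv, TeX L1714; = CCC 2021 Lemma 8.4)] -/
abbrev IsInter (u v : Fin n) : Prop := 0 < G.mult u v ∧ (G.pos v).2 = (G.pos u).2 + 1

/-- `{u, v}` is an edge inside a layer, left end first ("those edges have the form `{v, v+1}`").
[cite: BlaserDorflerIkenmeyer2020, Lemma 25, proof ("and `E_↔` those inside the layers") (arXiv, TeX L1714, L1733; = CCC 2021 Lemma 8.4)] -/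
abbrev IsIntra (u v : Fin n) : Prop :=
  0 < G.mult u v ∧ (G.pos v).2 = (G.pos u).2 ∧ (G.pos v).1 = (G.pos u).1 + 1

/-- The column `(u over v)` of an edge, in the new labels. [cite: BlaserDorflerIkenmeyer2020, Lemma 25, proof ("we add the column (u v) to `T̂_↕`") (arXiv, TeX L1720; = CCC 2021 Lemma 8.4)] -/
def col (u v : Fin n) : List ℕ := [G.label u, G.label v]

/-- The columns of `T̂_↕` before ordering: one column `(u over v)` per edge from a layer to the next,
"`k` times if the edge appears with multiplicity `k`".
[cite: BlaserDorflerIkenmeyer2020, Lemma 25, proof (arXiv, TeX L1720, L1739; = CCC 2021 Lemma 8.4)] -/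
def rawInter : List (List ℕ) :=
  (List.finRange n).flatMap fun u => (List.finRange n).flatMap fun v =>
    if G.IsInter u v then List.replicate (G.mult u v) (G.col u v) else []

/-- The columns of `T̂_↔` before ordering: one column `(v over v+1)` per edge inside a layer, with
multiplicity. [cite: BlaserDorflerIkenmeyer2020, Lemma 25, proof (arXiv, TeX L1733–1739; = CCC 2021 Lemma 8.4)] -/
def rawIntra : List (List ℕ) :=
  (List.finRange n).flatMap fun u => (List.finRange n).flatMap fun v =>
    if G.IsIntra u v then List.replicate (G.mult u v) (G.col u v) else []

/-- The left-to-right order on two-row columns: lexicographic in (top entry, bottom entry).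
[cite: BlaserDorflerIkenmeyer2020, Lemma 25, proof ("a unique order of the edges between these layers from left to right"; "combined in order") (arXiv, TeX L1719, L1736; = CCC 2021 Lemma 8.4)] -/
abbrev ColLE (c c' : List ℕ) : Prop :=
  c.getD 0 0 < c'.getD 0 0 ∨ (c.getD 0 0 = c'.getD 0 0 ∧ c.getD 1 0 ≤ c'.getD 1 0)

/-- **`T̂_↕`**: the columns `(u over v)`, `u < v`, of the edges between consecutive layers, with
multiplicity, ordered from left to right (layer pair by layer pair, concatenated).
[cite: BlaserDorflerIkenmeyer2020, Lemma 25, proof (arXiv, TeX L1717–1730; = CCC 2021 Lemma 8.4)] -/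
def interCols : List (List ℕ) := G.rawInter.insertionSort ColLE

/-- **`T̂_↔`**: the columns `(v over v+1)` of the edges inside the layers, with multiplicity,
"combined in order". [cite: BlaserDorflerIkenmeyer2020, Lemma 25, proof (arXiv, TeX L1731–1739; = CCC 2021 Lemma 8.4)] -/
def intraCols : List (List ℕ) := G.rawIntra.insertionSort ColLE

/-- The column order is transitive. [cite: BlaserDorflerIkenmeyer2020, Lemma 25, proof (arXiv, TeX L1711–1740; = CCC 2021 Lemma 8.4)] -/
theorem colLE_trans {a b c : List ℕ} (h₁ : ColLE a b) (h₂ : ColLE b c) : ColLE a c := by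
  unfold ColLE at *; omega

/-- The column order is total. [cite: BlaserDorflerIkenmeyer2020, Lemma 25, proof (arXiv, TeX L1711–1740; = CCC 2021 Lemma 8.4)] -/
theorem colLE_total (a b : List ℕ) : ColLE a b ∨ ColLE b a := by
  unfold ColLE; omega

/-! ### Membership: the columns are exactly the edges -/

/-- The unordered columns of `T̂_↕` are exactly the edges between consecutive layers. [cite: BlaserDorflerIkenmeyer2020, Lemma 25, proof (arXiv, TeX L1711–1740; = CCC 2021 Lemma 8.4)] -/
theorem mem_rawInter_iff {c : List ℕ} : c ∈ G.rawInter ↔ ∃ u v, G.IsInter u v ∧ c = G.col u v := by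
  simp only [rawInter, List.mem_flatMap, List.mem_finRange, true_and]
  constructor
  · rintro ⟨u, v, h⟩
    split_ifs at h with hp
    · exact ⟨u, v, hp, (List.mem_replicate.1 h).2⟩
    · simp at h
  · rintro ⟨u, v, hp, rfl⟩
    exact ⟨u, v, by rw [if_pos hp]; exact List.mem_replicate.2 ⟨hp.1.ne', rfl⟩⟩

/-- The unordered columns of `T̂_↔` are exactly the edges inside the layers. [cite: BlaserDorflerIkenmeyer2020, Lemma 25, proof (arXiv, TeX L1711–1740; = CCC 2021 Lemma 8.4)] -/
theorem mem_rawIntra_iff {c : List ℕ} : c ∈ G.rawIntra ↔ ∃ u v, G.IsIntra u v ∧ c = G.col u v := by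
  simp only [rawIntra, List.mem_flatMap, List.mem_finRange, true_and]
  constructor
  · rintro ⟨u, v, h⟩
    split_ifs at h with hp
    · exact ⟨u, v, hp, (List.mem_replicate.1 h).2⟩
    · simp at h
  · rintro ⟨u, v, hp, rfl⟩
    exact ⟨u, v, by rw [if_pos hp]; exact List.mem_replicate.2 ⟨hp.1.ne', rfl⟩⟩

/-- The columns of `T̂_↕` are exactly the edges between consecutive layers (lower end on top).
[cite: BlaserDorflerIkenmeyer2020, Lemma 25 ("`E_↕ = E(G_{T̂_↕})`") (arXiv, TeX L1715; = CCC 2021 Lemma 8.4)] -/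
theorem mem_interCols_iff {c : List ℕ} :
    c ∈ G.interCols ↔ ∃ u v, G.IsInter u v ∧ c = G.col u v := by
  rw [interCols, (List.perm_insertionSort _ _).mem_iff, mem_rawInter_iff]

/-- The columns of `T̂_↔` are exactly the edges inside the layers (left end on top).
[cite: BlaserDorflerIkenmeyer2020, Lemma 25 ("`E_↔ = E(G_{T̂_↔})`") (arXiv, TeX L1715; = CCC 2021 Lemma 8.4)] -/
theorem mem_intraCols_iff {c : List ℕ} :
    c ∈ G.intraCols ↔ ∃ u v, G.IsIntra u v ∧ c = G.col u v := by
  rw [intraCols, (List.perm_insertionSort _ _).mem_iff, mem_rawIntra_iff]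

/-- Every column of `T̂_↕` has height `2` (two-row shape). [cite: BlaserDorflerIkenmeyer2020, Lemma 25 ("semistandard Young tableau with two rows") (arXiv, TeX L1704; = CCC 2021 Lemma 8.4)] -/
theorem length_of_mem_interCols {c : List ℕ} (h : c ∈ G.interCols) : c.length = 2 := by
  obtain ⟨u, v, -, rfl⟩ := G.mem_interCols_iff.1 h; rfl

/-- Every column of `T̂_↔` has height `2`. [cite: BlaserDorflerIkenmeyer2020, Lemma 25 (arXiv, TeX L1704; = CCC 2021 Lemma 8.4)] -/
theorem length_of_mem_intraCols {c : List ℕ} (h : c ∈ G.intraCols) : c.length = 2 := by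
  obtain ⟨u, v, -, rfl⟩ := G.mem_intraCols_iff.1 h; rfl

/-! ### Semistandardness (Lemma 25, the two arguments of the proof) -/

/-- Along an edge to the next layer the key increases ("`u < v`"). [cite: BlaserDorflerIkenmeyer2020, Lemma 25, proof (arXiv, TeX L1711–1740; = CCC 2021 Lemma 8.4)] -/
theorem keyLT_of_isInter {u v : Fin n} (h : G.IsInter u v) : G.KeyLT u v := by
  unfold KeyLT; unfold IsInter at h; omega

/-- Along an edge to the right neighbour the key increases. [cite: BlaserDorflerIkenmeyer2020, Lemma 25, proof (arXiv, TeX L1711–1740; = CCC 2021 Lemma 8.4)] -/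
theorem keyLT_of_isIntra {u v : Fin n} (h : G.IsIntra u v) : G.KeyLT u v := by
  unfold KeyLT; unfold IsIntra at h; omega

/-- A two-element strictly increasing list is a chain. [folklore] -/
private theorem isChain_pair {a b : ℕ} (h : a < b) : List.IsChain (· < ·) [a, b] := by
  simp [h]

/-- The planarity argument of Lemma 25 for `T̂_↕`: if the column `(u over v)` is weakly left of
`(u' over v')` ("either `u' < u` in which case the edge `{u', v'}` would start left of `{u, v}` or
`v' < v` in which case [it] would end left of `{u, v}`, both a contradiction to our unique ordering
from left to right"), then `u ≤ u'` and `v ≤ v'` in the new labels.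
[cite: BlaserDorflerIkenmeyer2020, Lemma 25, proof (arXiv, TeX L1719–1730; = CCC 2021 Lemma 8.4)] -/
theorem label_le_of_colLE_of_isInter {u v u' v' : Fin n} (h : G.IsInter u v) (h' : G.IsInter u' v')
    (hc : ColLE (G.col u v) (G.col u' v')) :
    G.label u ≤ G.label u' ∧ G.label v ≤ G.label v' := by
  simp only [ColLE, col, List.getD_cons_zero, List.getD_cons_succ] at hc
  rcases hc with hlt | ⟨heq, hle⟩
  · refine ⟨hlt.le, ?_⟩
    rw [label_lt_label_iff] at hlt
    rw [label_le_label_iff]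
    unfold IsInter at h h'
    unfold KeyLT at hlt ⊢
    rcases hlt with hl | ⟨hl, hx⟩
    · omega
    · have := G.noncrossing u v u' v' h.1 h'.1 h.2 h'.2 hl.symm hx
      omega
  · exact ⟨heq.le, hle⟩

/-- The corresponding (easier) statement for `T̂_↔` ("those can clearly just be combined in order").
[cite: BlaserDorflerIkenmeyer2020, Lemma 25, proof (arXiv, TeX L1733–1737; = CCC 2021 Lemma 8.4)] -/
theorem label_le_of_colLE_of_isIntra {u v u' v' : Fin n} (h : G.IsIntra u v) (h' : G.IsIntra u' v')
    (hc : ColLE (G.col u v) (G.col u' v')) :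
    G.label u ≤ G.label u' ∧ G.label v ≤ G.label v' := by
  simp only [ColLE, col, List.getD_cons_zero, List.getD_cons_succ] at hc
  rcases hc with hlt | ⟨heq, hle⟩
  · refine ⟨hlt.le, ?_⟩
    rw [label_lt_label_iff] at hlt
    rw [label_le_label_iff]
    unfold IsIntra at h h'
    unfold KeyLT at hlt ⊢
    omega
  · exact ⟨heq.le, hle⟩

/-- **Lemma 25, `T̂_↕` is semistandard.** [cite: BlaserDorflerIkenmeyer2020, Lemma 25 (arXiv, TeX L1705–1710, proof L1717–1730; = CCC 2021 Lemma 8.4)] -/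
theorem isSemistandard_interCols : IsSemistandard G.interCols := by
  constructor
  · intro c hc
    obtain ⟨u, v, h, rfl⟩ := G.mem_interCols_iff.1 hc
    exact isChain_pair (G.label_lt_label (G.keyLT_of_isInter h))
  · apply List.Pairwise.isChain
    haveI : Std.Total ColLE := ⟨colLE_total⟩
    haveI : IsTrans (List ℕ) ColLE := ⟨fun _ _ _ => colLE_trans⟩
    have hP := List.pairwise_insertionSort ColLE G.rawInter
    refine hP.imp_of_mem ?_
    intro c c' hc hc' hle
    obtain ⟨u, v, h, rfl⟩ := G.mem_interCols_iff.1 hc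
    obtain ⟨u', v', h', rfl⟩ := G.mem_interCols_iff.1 hc'
    obtain ⟨h0, h1⟩ := G.label_le_of_colLE_of_isInter h h' hle
    intro i hi
    have hi2 : i < 2 := by simpa [col] using hi
    interval_cases i <;> simp [col, h0, h1]

/-- **Lemma 25, `T̂_↔` is semistandard.** [cite: BlaserDorflerIkenmeyer2020, Lemma 25 (arXiv, TeX L1705–1710, proof L1731–1737; = CCC 2021 Lemma 8.4)] -/
theorem isSemistandard_intraCols : IsSemistandard G.intraCols := by
  constructor
  · intro c hc
    obtain ⟨u, v, h, rfl⟩ := G.mem_intraCols_iff.1 hc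
    exact isChain_pair (G.label_lt_label (G.keyLT_of_isIntra h))
  · apply List.Pairwise.isChain
    haveI : Std.Total ColLE := ⟨colLE_total⟩
    haveI : IsTrans (List ℕ) ColLE := ⟨fun _ _ _ => colLE_trans⟩
    have hP := List.pairwise_insertionSort ColLE G.rawIntra
    refine hP.imp_of_mem ?_
    intro c c' hc hc' hle
    obtain ⟨u, v, h, rfl⟩ := G.mem_intraCols_iff.1 hc
    obtain ⟨u', v', h', rfl⟩ := G.mem_intraCols_iff.1 hc'
    obtain ⟨h0, h1⟩ := G.label_le_of_colLE_of_isIntra h h' hle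
    intro i hi
    have hi2 : i < 2 := by simpa [col] using hi
    interval_cases i <;> simp [col, h0, h1]

/-- "Those edges have the form `{v, v+1}`": along an edge inside a layer the new labels are
consecutive. [cite: BlaserDorflerIkenmeyer2020, Lemma 25, proof (arXiv, TeX L1733; = CCC 2021 Lemma 8.4)] -/
theorem label_eq_label_add_one_of_isIntra {u v : Fin n} (h : G.IsIntra u v) :
    G.label v = G.label u + 1 := by
  have hkey := G.keyLT_of_isIntra h
  unfold label
  have hset : (Finset.univ.filter fun w => G.KeyLT w v) =
      insert u (Finset.univ.filter fun w => G.KeyLT w u) := by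
    ext w
    simp only [Finset.mem_filter, Finset.mem_univ, true_and, Finset.mem_insert]
    constructor
    · intro hw
      by_cases hwu : w = u
      · exact Or.inl hwu
      · right
        rcases G.keyLT_or_keyLT hwu with hlt | hlt
        · exact hlt
        · exfalso
          unfold IsIntra at h
          unfold KeyLT at hw hlt
          omega
    · rintro (rfl | hw)
      · exact hkey
      · exact G.keyLT_trans hw hkey
  rw [hset, Finset.card_insert_of_notMem (by simp [G.keyLT_irrefl u])]

/-! ### Multiplicities: each edge contributes its multiplicity of columns (Lemma 25, last sentence) -/

/-- Counting in a double `flatMap` over `Fin n` is a double sum. [folklore] -/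
private theorem count_flatMap₂ (B : Fin n → Fin n → List (List ℕ)) (c : List ℕ) :
    ((List.finRange n).flatMap fun u => (List.finRange n).flatMap fun v => B u v).count c =
      ∑ u, ∑ v, (B u v).count c := by
  rw [Fin.sum_univ_def, List.count_flatMap]
  congr 1
  refine List.map_congr_left fun u _ => ?_
  rw [Function.comp_apply, List.count_flatMap, Fin.sum_univ_def]
  rfl

/-- Columns in the new labels determine the oriented edge (the relabelling is injective). [cite: BlaserDorflerIkenmeyer2020, Lemma 25, proof (arXiv, TeX L1711–1740; = CCC 2021 Lemma 8.4)] -/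
theorem col_eq_col_iff {u v u' v' : Fin n} : G.col u v = G.col u' v' ↔ u = u' ∧ v = v' := by
  simp [col]

/-- The count of one column in one block of the raw column list. [folklore] -/
private theorem count_col_ite (P : Fin n → Fin n → Prop) [DecidableRel P] (u v u' v' : Fin n) :
    (if P u' v' then List.replicate (G.mult u' v') (G.col u' v') else []).count (G.col u v) =
      if u' = u ∧ v' = v then (if P u v then G.mult u v else 0) else 0 := by
  by_cases he : u' = u ∧ v' = v
  · obtain ⟨rfl, rfl⟩ := he
    by_cases hp : P u' v'
    · simp [hp]
    · simp [hp]
  · rw [if_neg he]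
    by_cases hp : P u' v'
    · have hne : G.col u' v' ≠ G.col u v := fun h' => he (G.col_eq_col_iff.1 h')
      simp [hp, List.count_replicate, hne]
    · simp [hp]

/-- A double sum of a double Kronecker delta. [folklore] -/
private theorem sum_sum_ite_eq_and (f : Fin n → Fin n → ℕ) (u v : Fin n) :
    (∑ u', ∑ v', if u' = u ∧ v' = v then f u' v' else 0) = f u v := by
  rw [Finset.sum_eq_single u (fun u' _ hu' => by simp [hu']) (by simp)]
  rw [Finset.sum_eq_single v (fun v' _ hv' => by simp [hv']) (by simp)]
  simp

/-- **Multiplicities in `T̂_↕`:** the column `(u over v)` occurs exactly `mult u v` times when `{u, v}`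
is an edge from a layer to the next, and not at all otherwise ("we add every column to the tableaux
`k` times if the edge appears with multiplicity `k`").
[cite: BlaserDorflerIkenmeyer2020, Lemma 25, proof (arXiv, TeX L1739; = CCC 2021 Lemma 8.4)] -/
theorem count_interCols_col (u v : Fin n) :
    G.interCols.count (G.col u v) = if G.IsInter u v then G.mult u v else 0 := by
  rw [interCols, (List.perm_insertionSort _ _).count_eq, rawInter, count_flatMap₂]
  simp_rw [G.count_col_ite]
  exact sum_sum_ite_eq_and _ u v

/-- **Multiplicities in `T̂_↔`.** [cite: BlaserDorflerIkenmeyer2020, Lemma 25, proof (arXiv, TeX L1739; = CCC 2021 Lemma 8.4)] -/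
theorem count_intraCols_col (u v : Fin n) :
    G.intraCols.count (G.col u v) = if G.IsIntra u v then G.mult u v else 0 := by
  rw [intraCols, (List.perm_insertionSort _ _).count_eq, rawIntra, count_flatMap₂]
  simp_rw [G.count_col_ite]
  exact sum_sum_ite_eq_and _ u v

/-! ### The decomposition `E = E(G_{T̂_↔}) ∪ E(G_{T̂_↕})` and the content of `T̂_↔ T̂_↕` -/

/-- Exactly one of the four orientations/kinds applies to an edge (items (3), (4)); none to a
non-edge. [cite: BlaserDorflerIkenmeyer2020, Def. 24 (3), (4) and Lemma 25 ("Clearly `E_↔ ∪ E_↕ = E`") (arXiv, TeX L1671–1672, L1715; = CCC 2021 Def. 8.3, Lemma 8.4)] -/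
theorem ite_isInter_add (w v : Fin n) :
    (if G.IsInter w v then G.mult w v else 0) + (if G.IsInter v w then G.mult v w else 0) +
      ((if G.IsIntra w v then G.mult w v else 0) + (if G.IsIntra v w then G.mult v w else 0)) =
      G.mult w v := by
  have hc : G.mult v w = G.mult w v := G.mult_comm v w
  by_cases h0 : G.mult w v = 0
  · have h0' : G.mult v w = 0 := hc.trans h0
    simp [IsInter, IsIntra, h0, h0']
  · have hpos : 0 < G.mult w v := Nat.pos_of_ne_zero h0
    have hpos' : 0 < G.mult v w := by rw [hc]; exact hpos
    by_cases hl : (G.pos w).2 = (G.pos v).2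
    · have hi := G.intra_adj w v hpos hl
      simp only [IsInter, IsIntra, hpos, hpos', true_and]
      split_ifs <;> omega
    · have hi := G.inter_adj w v hpos hl
      simp only [IsInter, IsIntra, hpos, hpos', true_and]
      split_ifs <;> omega

/-- **Lemma 25, `E = E(G_{T̂_↔}) ∪ E(G_{T̂_↕})` with multiplicity:** the number of columns joining the
labels of `u` and `v` in `T̂_↕ T̂_↔` (either orientation) is the multiplicity of the edge `{u, v}`.
[cite: BlaserDorflerIkenmeyer2020, Lemma 25 (arXiv, TeX L1705–1710, L1715, L1739; = CCC 2021 Lemma 8.4)] -/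
theorem count_cols_add_count_cols (u v : Fin n) :
    (G.interCols ++ G.intraCols).count (G.col u v) + (G.interCols ++ G.intraCols).count (G.col v u) =
      G.mult u v := by
  rw [List.count_append, List.count_append, count_interCols_col, count_intraCols_col,
    count_interCols_col, count_intraCols_col]
  linarith [G.ite_isInter_add u v]

/-- **Lemma 25, `E = E(G_{T̂_↔}) ∪ E(G_{T̂_↕})` as sets:** `{u, v}` is an edge iff some column of
`T̂_↕` or `T̂_↔` is `(u over v)` or `(v over u)` in the new labels.
[cite: BlaserDorflerIkenmeyer2020, Lemma 25 (arXiv, TeX L1705–1707, L1715; = CCC 2021 Lemma 8.4)] -/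
theorem mult_pos_iff_mem_cols (u v : Fin n) :
    0 < G.mult u v ↔ G.col u v ∈ G.interCols ++ G.intraCols ∨ G.col v u ∈ G.interCols ++ G.intraCols := by
  have h := G.count_cols_add_count_cols u v
  constructor
  · intro hpos
    by_contra hc
    simp only [not_or] at hc
    rw [List.count_eq_zero_of_not_mem hc.1, List.count_eq_zero_of_not_mem hc.2] at h
    omega
  · rintro (hm | hm)
    · have := List.count_pos_iff.2 hm; omega
    · have := List.count_pos_iff.2 hm; omega

/-- The graph of a concatenation of tableaux is the union of the graphs. [cite: BlaserDorflerIkenmeyer2020, §7 (the graph `G_S` of a tableau) and Lemma 25 (arXiv; = CCC 2021 §7, Lemma 8.4)] -/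
theorem tableauGraph_append (S S' : List (List ℕ)) (m : ℕ) :
    tableauGraph (S ++ S') m = tableauGraph S m ⊔ tableauGraph S' m := by
  ext i j
  simp only [tableauGraph, SimpleGraph.fromRel_adj, SimpleGraph.sup_adj, List.mem_append]
  constructor
  · rintro ⟨hne, h⟩
    rcases h with ⟨c, hc | hc, hi, hj⟩ | ⟨c, hc | hc, hi, hj⟩
    · exact Or.inl ⟨hne, Or.inl ⟨c, hc, hi, hj⟩⟩
    · exact Or.inr ⟨hne, Or.inl ⟨c, hc, hi, hj⟩⟩
    · exact Or.inl ⟨hne, Or.inr ⟨c, hc, hi, hj⟩⟩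
    · exact Or.inr ⟨hne, Or.inr ⟨c, hc, hi, hj⟩⟩
  · rintro (⟨hne, h⟩ | ⟨hne, h⟩)
    · rcases h with ⟨c, hc, hi, hj⟩ | ⟨c, hc, hi, hj⟩
      · exact ⟨hne, Or.inl ⟨c, Or.inl hc, hi, hj⟩⟩
      · exact ⟨hne, Or.inr ⟨c, Or.inl hc, hi, hj⟩⟩
    · rcases h with ⟨c, hc, hi, hj⟩ | ⟨c, hc, hi, hj⟩
      · exact ⟨hne, Or.inl ⟨c, Or.inr hc, hi, hj⟩⟩
      · exact ⟨hne, Or.inr ⟨c, Or.inr hc, hi, hj⟩⟩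

/-- The new label of a vertex as an element of `Fin n`. [cite: BlaserDorflerIkenmeyer2020, Lemma 25 ("for some relabeling of the vertices") (arXiv; = CCC 2021 Lemma 8.4)] -/
def labelFin (v : Fin n) : Fin n := ⟨G.label v, G.label_lt v⟩

/-- The relabelling (as a self-map of `Fin n`) is injective. [cite: BlaserDorflerIkenmeyer2020, Lemma 25, proof (arXiv, TeX L1711–1740; = CCC 2021 Lemma 8.4)] -/
theorem labelFin_injective : Function.Injective G.labelFin := fun u v h =>
  G.label_injective (by simpa [labelFin] using congrArg Fin.val h)

/-- The relabelling is a bijection of the vertex set. [cite: BlaserDorflerIkenmeyer2020, Lemma 25 ("for some relabeling of the vertices") (arXiv; = CCC 2021 Lemma 8.4)] -/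
theorem labelFin_bijective : Function.Bijective G.labelFin :=
  Finite.injective_iff_bijective.1 G.labelFin_injective

/-- **Lemma 25, main statement: `G = (V, E(G_{T̂_↔}) ∪ E(G_{T̂_↕}))` after relabelling** — the simple
graph underlying `G`, transported along the relabelling, is the graph (§7) of the tableau `T̂_↕ T̂_↔`,
equivalently `G_{T̂_↕} ⊔ G_{T̂_↔}` (`tableauGraph_append`).
[cite: BlaserDorflerIkenmeyer2020, Lemma 25 (arXiv, TeX L1705–1710; = CCC 2021 Lemma 8.4)] -/
theorem tableauGraph_cols_adj_iff (u v : Fin n) :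
    (tableauGraph (G.interCols ++ G.intraCols) n).Adj (G.labelFin u) (G.labelFin v) ↔ 0 < G.mult u v := by
  rw [tableauGraph, SimpleGraph.fromRel_adj, G.mult_pos_iff_mem_cols]
  simp only [labelFin, ne_eq, Fin.mk.injEq, label_eq_label_iff]
  constructor
  · rintro ⟨hne, h⟩
    have key : ∀ {a b : Fin n}, a ≠ b → (∃ c ∈ G.interCols ++ G.intraCols, G.label a ∈ c ∧ G.label b ∈ c) →
        G.col a b ∈ G.interCols ++ G.intraCols ∨ G.col b a ∈ G.interCols ++ G.intraCols := by
      intro a b hab ⟨c, hc, ha, hb⟩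
      have hc' : ∃ x y, c = G.col x y := by
        rcases List.mem_append.1 hc with hc | hc
        · obtain ⟨x, y, -, rfl⟩ := G.mem_interCols_iff.1 hc; exact ⟨x, y, rfl⟩
        · obtain ⟨x, y, -, rfl⟩ := G.mem_intraCols_iff.1 hc; exact ⟨x, y, rfl⟩
      obtain ⟨x, y, rfl⟩ := hc'
      simp only [col, List.mem_cons, List.not_mem_nil, or_false, label_eq_label_iff] at ha hb
      rcases ha with rfl | rfl <;> rcases hb with rfl | rfl
      · exact absurd rfl hab
      · exact Or.inl hc
      · exact Or.inr hc
      · exact absurd rfl hab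
    rcases h with h | h
    · exact key hne h
    · exact (key (Ne.symm hne) h).symm
  · intro h
    have hne : u ≠ v := by
      rintro rfl
      have := G.mult_pos_iff_mem_cols u u |>.2 h
      exact absurd (G.mult_self u) this.ne'
    refine ⟨hne, ?_⟩
    rcases h with h | h
    · exact Or.inl ⟨_, h, by simp [col], by simp [col]⟩
    · exact Or.inr ⟨_, h, by simp [col], by simp [col]⟩

/-! ### Content: every label occurs `deg` times; `T̂_↕` contains every label -/

/-- The sum of a `flatMap` is the sum of the block sums. [folklore] -/
private theorem sum_flatMap' {α : Type*} (l : List α) (f : α → List ℕ) :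
    (l.flatMap f).sum = (l.map fun a => (f a).sum).sum := by
  induction l with
  | nil => simp
  | cons a l ih => simp [List.flatMap_cons, List.sum_append, ih]

/-- Summing a function over a double `flatMap` over `Fin n` is a double sum. [folklore] -/
private theorem sum_map_flatMap₂ (B : Fin n → Fin n → List (List ℕ)) (g : List ℕ → ℕ) :
    (((List.finRange n).flatMap fun u => (List.finRange n).flatMap fun v => B u v).map g).sum =
      ∑ u, ∑ v, ((B u v).map g).sum := by
  rw [List.map_flatMap, sum_flatMap', Fin.sum_univ_def]
  congr 1
  refine List.map_congr_left fun u _ => ?_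
  rw [List.map_flatMap, sum_flatMap', Fin.sum_univ_def]

/-- How often the new label of `w` occurs in the column `(u over v)`. [cite: BlaserDorflerIkenmeyer2020, Lemma 25, proof (arXiv, TeX L1711–1740; = CCC 2021 Lemma 8.4)] -/
theorem count_label_col (w u v : Fin n) :
    (G.col u v).count (G.label w) = (if u = w then 1 else 0) + (if v = w then 1 else 0) := by
  simp only [col, List.count_cons, List.count_nil, beq_iff_eq, label_eq_label_iff]
  ring

/-- The label count of one block of the raw column list. [folklore] -/
private theorem sum_map_count_ite (P : Fin n → Fin n → Prop) [DecidableRel P] (w u v : Fin n) :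
    ((if P u v then List.replicate (G.mult u v) (G.col u v) else []).map (List.count (G.label w))).sum =
      (if P u v then G.mult u v else 0) * ((if u = w then 1 else 0) + (if v = w then 1 else 0)) := by
  by_cases hp : P u v
  · rw [if_pos hp, if_pos hp, List.map_replicate, List.sum_replicate, count_label_col, smul_eq_mul]
  · rw [if_neg hp, if_neg hp]; simp

/-- Collapsing a double sum against `[u = w] + [v = w]`. [folklore] -/
private theorem sum_sum_mul_indicator (F : Fin n → Fin n → ℕ) (w : Fin n) :
    (∑ u, ∑ v, F u v * ((if u = w then 1 else 0) + (if v = w then 1 else 0))) =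
      (∑ v, F w v) + ∑ u, F u w := by
  simp only [mul_add, Finset.sum_add_distrib, mul_ite, mul_one, mul_zero]
  congr 1
  · rw [Finset.sum_comm]
    simp
  · simp

/-- **Content of `T̂_↕ T̂_↔`:** the new label of `w` occurs exactly `deg w` times (edges counted with
multiplicity) — so for an `8`-regular `G` every label occurs `8` times, and `16` times after doubling
every column (what the proof of Thm. 30 uses: "`T̂` contains every entry exactly `16` times").
[cite: BlaserDorflerIkenmeyer2020, Lemma 25 with Thm. 30, proof (arXiv, TeX L1705–1710, L1739, L2390–2391, L2414; = CCC 2021 Lemma 8.4, Thm. 8.9)] -/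
theorem sum_count_label (w : Fin n) :
    ((G.interCols ++ G.intraCols).map (List.count (G.label w))).sum = G.degree w := by
  rw [List.map_append, List.sum_append, interCols, intraCols,
    ((List.perm_insertionSort ColLE G.rawInter).map _).sum_eq,
    ((List.perm_insertionSort ColLE G.rawIntra).map _).sum_eq, rawInter, rawIntra,
    sum_map_flatMap₂, sum_map_flatMap₂]
  simp_rw [G.sum_map_count_ite, sum_sum_mul_indicator]
  unfold degree
  rw [show ((∑ v, if G.IsInter w v then G.mult w v else 0) + ∑ u, if G.IsInter u w then G.mult u w else 0) +
      ((∑ v, if G.IsIntra w v then G.mult w v else 0) + ∑ u, if G.IsIntra u w then G.mult u w else 0) =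
      ∑ v, ((if G.IsInter w v then G.mult w v else 0) + (if G.IsInter v w then G.mult v w else 0) +
        ((if G.IsIntra w v then G.mult w v else 0) + (if G.IsIntra v w then G.mult v w else 0))) by
    simp only [Finset.sum_add_distrib]]
  exact Finset.sum_congr rfl fun v _ => G.ite_isInter_add w v

/-- **Lemma 25, "Additionally `T̂_↕` contains every number … at least once"** (item (6): every vertex
has a neighbour in a different layer). [cite: BlaserDorflerIkenmeyer2020, Lemma 25 (arXiv, TeX L1709, proof L1715; = CCC 2021 Lemma 8.4)] -/
theorem exists_mem_interCols_label_mem (w : Fin n) : ∃ c ∈ G.interCols, G.label w ∈ c := by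
  obtain ⟨v, hpos, hl⟩ := G.exists_inter w
  rcases G.inter_adj w v hpos (Ne.symm hl) with h | h
  · exact ⟨G.col w v, G.mem_interCols_iff.2 ⟨w, v, ⟨hpos, h⟩, rfl⟩, by simp [col]⟩
  · refine ⟨G.col v w, G.mem_interCols_iff.2 ⟨v, w, ⟨?_, h⟩, rfl⟩, by simp [col]⟩
    rw [G.mult_comm]; exact hpos

/-! ### Colourings and regularity (the objects of Lemmas 26, 29 and Thm. 30) -/

/-- A proper `3`-colouring of the multigraph (multiplicities are irrelevant).
[cite: BlaserDorflerIkenmeyer2020, Lemma 26 ("admits a proper `3`-coloring") (arXiv, TeX L1800–1804; = CCC 2021 Lemma 8.5)] -/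
def IsProper3 (c : Fin n → Fin 3) : Prop := ∀ u v, 0 < G.mult u v → c u ≠ c v

/-- `d`-regularity with multiplicity ("`8`-regular, i.e. each vertex has degree exactly `8`").
[cite: BlaserDorflerIkenmeyer2020, §8 (arXiv, TeX L1663; = CCC 2021 §8)] -/
def IsRegular (d : ℕ) : Prop := ∀ v, G.degree v = d

/-- For a `d`-regular grid-like layered multigraph every new label occurs exactly `d` times in
`T̂_↕ T̂_↔`. [cite: BlaserDorflerIkenmeyer2020, Lemma 25 with Thm. 30, proof (arXiv, TeX L2414; = CCC 2021 Lemma 8.4, Thm. 8.9)] -/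
theorem sum_count_label_of_isRegular {d : ℕ} (hd : G.IsRegular d) (w : Fin n) :
    ((G.interCols ++ G.intraCols).map (List.count (G.label w))).sum = d := by
  rw [sum_count_label, hd w]

end GridLikeLayered

/-! ## Relational `3`-colouring on subgraphs of grids (the problem of Lemma 28 [8.7]) -/

/-- Unit-grid neighbours in `ℕ × ℕ`. [cite: BlaserDorflerIkenmeyer2020, Lemma 28 ("subgraphs `G` of grids") (arXiv, TeX L2078, L2083–2086; = CCC 2021 Lemma 8.7)] -/
def GridAdjacent (p q : ℕ × ℕ) : Prop :=
  (p.1 = q.1 ∧ (q.2 = p.2 + 1 ∨ p.2 = q.2 + 1)) ∨ (p.2 = q.2 ∧ (q.1 = p.1 + 1 ∨ p.1 = q.1 + 1))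

/-- Grid adjacency is symmetric. [cite: BlaserDorflerIkenmeyer2020, §8 before Lemma 28 ("the graph is a subset of a grid graph") (arXiv, TeX L2078; = CCC 2021 §8)] -/
theorem gridAdjacent_comm {p q : ℕ × ℕ} : GridAdjacent p q ↔ GridAdjacent q p := by
  unfold GridAdjacent; omega

/-- Grid adjacency is irreflexive. [cite: BlaserDorflerIkenmeyer2020, §8 before Lemma 28 ("the graph is a subset of a grid graph") (arXiv, TeX L2078; = CCC 2021 §8)] -/
theorem gridAdjacent_irrefl (p : ℕ × ℕ) : ¬ GridAdjacent p p := by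
  unfold GridAdjacent; omega

/-- **A subgraph of a grid with equality and inequality edges** ("a variant of `3`-coloring where the
graph is a subset of a grid graph and every edge can either be an equality or inequality edge"): vertex
set `Fin N` injectively placed in `ℕ × ℕ`, two symmetric edge predicates, every edge a unit grid edge.
[cite: BlaserDorflerIkenmeyer2020, §8 before Lemma 28 (arXiv, TeX L2078–2079; = CCC 2021 §8, before Lemma 8.7)] -/
structure RelGridGraph (N : ℕ) where
  /-- the placement in the grid -/
  pos : Fin N → ℕ × ℕ
  pos_injective : Function.Injective pos
  /-- equality edges -/
  eqAdj : Fin N → Fin N → Bool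
  /-- inequality edges -/
  neAdj : Fin N → Fin N → Bool
  eqAdj_comm : ∀ u v, eqAdj u v = eqAdj v u
  neAdj_comm : ∀ u v, neAdj u v = neAdj v u
  eqAdj_grid : ∀ u v, eqAdj u v = true → GridAdjacent (pos u) (pos v)
  neAdj_grid : ∀ u v, neAdj u v = true → GridAdjacent (pos u) (pos v)

namespace RelGridGraph

variable {N : ℕ} (H : RelGridGraph N)

/-- A proper relational `3`-colouring: "vertices connected by an equality edge have to be colored by
the same color and vertices connected by an inequality edge have to be colored with different
colors". [cite: BlaserDorflerIkenmeyer2020, §8 before Lemma 28 (arXiv, TeX L2078; = CCC 2021 §8, before Lemma 8.7)] -/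
def IsProperRel (c : Fin N → Fin 3) : Prop :=
  (∀ u v, H.eqAdj u v = true → c u = c v) ∧ ∀ u v, H.neAdj u v = true → c u ≠ c v

/-- Relational `3`-colourability. [cite: BlaserDorflerIkenmeyer2020, Lemma 28 ("relational `3`-coloring on subgraphs `G` of grids") (arXiv, TeX L2083–2086; = CCC 2021 Lemma 8.7)] -/
def IsRelColourable (H : RelGridGraph N) : Prop := ∃ c : Fin N → Fin 3, H.IsProperRel c

/-- No equality loops (grid adjacency is irreflexive). [cite: BlaserDorflerIkenmeyer2020, §8 before Lemma 28 ("the graph is a subset of a grid graph") (arXiv, TeX L2078; = CCC 2021 §8)] -/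
theorem eqAdj_self (v : Fin N) : H.eqAdj v v = false := by
  by_contra h
  exact gridAdjacent_irrefl _ (H.eqAdj_grid v v (by simpa using h))

/-- No inequality loops (grid adjacency is irreflexive). [cite: BlaserDorflerIkenmeyer2020, §8 before Lemma 28 ("the graph is a subset of a grid graph") (arXiv, TeX L2078; = CCC 2021 §8)] -/
theorem neAdj_self (v : Fin N) : H.neAdj v v = false := by
  by_contra h
  exact gridAdjacent_irrefl _ (H.neAdj_grid v v (by simpa using h))

end RelGridGraph

/-! ## The example of Fig. `fig:gridlikeexample` / `fig:gridlikeexampledecomp` (non-vacuity and a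
check of the decomposition against the printed tableaux) -/

namespace GridLikeLayered

/-- The edge list of the example: inter-layer `1/4, 1/5, 2/5, 3/5, 5/6, 5/7`, intra-layer
`1/2, 2/3, 6/7` (tikz names; here `0`-based). [cite: BlaserDorflerIkenmeyer2020, Fig. gridlikeexample (arXiv, TeX L1681–1703; = CCC 2021 Fig. 5)] -/
def exampleEdges : List (Fin 7 × Fin 7) :=
  [(0,3), (0,4), (1,4), (2,4), (4,5), (4,6), (0,1), (1,2), (5,6)]

/-- **The example grid-like layered graph** of Fig. `fig:gridlikeexample`: `7` vertices at
`1 ↦ (1, L₁)`, `2 ↦ (2, L₁)`, `3 ↦ (3, L₁)`, `4 ↦ (1, L₂)`, `5 ↦ (2, L₂)`, `6 ↦ (2, L₃)`, `7 ↦ (3, L₃)`,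
all multiplicities `1`; the six Def-24 fields are checked by `decide`.
[cite: BlaserDorflerIkenmeyer2020, Fig. gridlikeexample (arXiv, TeX L1681–1703; = CCC 2021 §8)] -/
def exampleGraph : GridLikeLayered 7 where
  pos := ![(1,1), (2,1), (3,1), (1,2), (2,2), (2,3), (3,3)]
  mult u v := if (u, v) ∈ exampleEdges ∨ (v, u) ∈ exampleEdges then 1 else 0
  mult_comm := by decide
  mult_self := by decide
  pos_injective := by decide
  inter_adj := by decide
  intra_adj := by decide
  noncrossing := by decide
  exists_inter := by decide

/-- The decomposition computed for the example IS the printed one (Fig. `fig:gridlikeexampledecomp`,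
labels shifted to `0`-based): `T̂_↕ = (1 1 2 3 5 5 / 4 5 5 5 6 7)` and `T̂_↔ = (1 2 6 / 2 3 7)`.
[cite: BlaserDorflerIkenmeyer2020, Fig. gridlikeexampledecomp (arXiv, TeX L1741–1790; = CCC 2021 §8)] -/
theorem exampleGraph_interCols :
    exampleGraph.interCols = [[0,3], [0,4], [1,4], [2,4], [4,5], [4,6]] := by
  decide

/-- … and `T̂_↔ = (1 2 6 / 2 3 7)` (`0`-based). [cite: BlaserDorflerIkenmeyer2020, Fig. gridlikeexampledecomp (arXiv, TeX L1741–1790; = CCC 2021 §8)] -/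
theorem exampleGraph_intraCols : exampleGraph.intraCols = [[0,1], [1,2], [5,6]] := by
  decide

end GridLikeLayered

end BDI2020

end Literature.Computability.AlgebraicComplexity
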